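import Summits.CriticalPhenomena.PercolationContinuityZ3.Theorems.SahiMasterFamilyFourStep
import Summits.CriticalPhenomena.PercolationContinuityZ3.Theorems.PercNearOneGluingNoHeavyLowerTailSahiCombMasterFamily

/-!
# The comb (tensor-Bernstein) hierarchy for Sahi's `E_k`, IX: (M⁺-4) UNCONDITIONALLY on quadruples with a `Z_3` sub-triple

Support file of the one-cut programme (crux `NoHeavyLowerTail`, stmt-CriticalPhenomena-4575; cell `prim-masterthm`, seat P3, gen 3;
`run/shared/lean/prim/prim-masterthm/prim-masterthm-p3/HIERARCHY.md` §10).  Vocabulary: `SahiComb.CombPos`, `covFun`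
(`…SahiCombPositivity`, `…SahiCombMasterFamily`); `SuppZeroFlag`, `ZVia`, the forced-open hull and the order-four identity
`sahiE_four_eq_of_zVia` of unit `prim-master-conj` (`SahiMasterFamilySandwich`, `SahiMasterFamilyFourStep`).

THE POINT.  `SahiMasterFamilyFourStep` proves Sahi's `E_4 ≥ 0` for every quadruple of increasing events containing a `Z_3` sub-triple
(the order-four step of the master conjecture WITHOUT Kahn's Conjecture 5) from the exact identity, for `(X, Y, G) ∈ Z_3` via `(X, Y)`
and `K` the forced-open hull of `G`,
  `E_4(G, D, X, Y) = 2·[Cov(X, KDY) + Cov(Y, KDX) + Cov(K, DXY)] + (P(K) − P(G))·[Cov(DX, Y) + Cov(X, DY)]`.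
Every term is a product of covariances of increasing events — comb-positive at multidegree `2` by (M⁺-2)
(`combPos_covFun`) — and the defect `P(K) − P(G) = P(K ∖ G)` (`G ⊆ K`), comb-positive at multidegree `1` (`combPos_ex`).
So the identity lifts verbatim from (M-4) to the strictly stronger coefficientwise statement (M⁺-4):
* `combPos_sahiE_four_of_zVia` — named form (`X, Y` nonempty);
* `combPos_sahiE_four_ind_of_zeroFlagTriple` — **for every finite cube and every quadruple of increasing events `U` such that the
  three events other than `U_m` form a zero flag of order `3`, `p ↦ E_4(μ_p; 1_{U_0},…,1_{U_3})` is a nonnegative combination of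
  the degree-4 tensor-Bernstein basis** (a SEVENTH unconditional comb stratum at order 4, next to the five of `…SahiCombStrata` /
  `…SahiCombResidualStep`, the P-class of `…SahiCombPrincipalMeet` and the separable class; the comb R6 rung
  `combPos_sahiE_ind_of_zeroFlag` needs (M⁺-3) at order 4, this one needs nothing);
* `sahiE_four_ind_eq_zero_of_interior_zero_of_zeroFlagTriple` — density-free zeros on this class (a by-product of comb positivity;
  the sharper pointwise statement `E_4(μ_p) = 0 ↔ U ∈ Z_4` is `sahiE_four_ind_eq_zero_iff_of_zeroFlagTriple`).
HONEST FRAMING: nothing here asserts (M⁺-k) or `C_k` for `k ≥ 3` in general. [this work]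
-/

noncomputable section

open scoped Classical

namespace Summit.CriticalPhenomena.PercolationContinuityZ3.Theorems

open Finset Function MeasureTheory
open Literature.Combinatorics.Sahi2008
open Literature.Probability.LatticeModels (prodBernoulli)
open Literature.Probability.Percolation.DecisionTree (ind ind_of_mem ind_of_not_mem ind_nonneg)
open SahiComb

namespace SahiCombFourStep

variable {ι : Type*} [Fintype ι]

/-- `covFun` in measure language: `Cov(U,V) = P(U ∩ V) − P(U)P(V)`. [folklore] -/
theorem covFun_eq_real (U V : Set (Set ι)) (p : ι → unitInterval) :
    covFun U V p = (prodBernoulli p).real (U ∩ V) - (prodBernoulli p).real U * (prodBernoulli p).real V := by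
  simp only [covFun, ex_bernoulliWeight_ind]

/-- The defect `P(K) − P(G)` of a nested pair `G ⊆ K` is comb-positive at multidegree `1` (it is `P(K ∖ G)`). [this work] -/
theorem combPos_real_sub_real_of_subset {G K : Set (Set ι)} (hGK : G ⊆ K) :
    CombPos (fun _ : ι => 1) (fun p => (prodBernoulli p).real K - (prodBernoulli p).real G) := by
  have h := combPos_ex (ι := ι) (h := fun ω => ind K ω - ind G ω) fun ω => by
    by_cases hK : ω ∈ K
    · rw [ind_of_mem hK]
      by_cases hG : ω ∈ G
      · rw [ind_of_mem hG]; norm_num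
      · rw [ind_of_not_mem hG]; norm_num
    · rw [ind_of_not_mem hK, ind_of_not_mem (fun hG => hK (hGK hG))]; norm_num
  refine h.congr fun p => ?_
  rw [← ex_bernoulliWeight_ind, ← ex_bernoulliWeight_ind]
  simp only [ex_def, mul_sub, sum_sub_distrib]

/-- **(M⁺-4) on a `Z_3` sub-triple, named form.**  For increasing `X, Y, G, D` with `X, Y` nonempty and `ZVia X Y G`,
`p ↦ E_4(μ_p; 1_G, 1_D, 1_X, 1_Y)` is comb-positive at multidegree `4`. [this work] -/
theorem combPos_sahiE_four_of_zVia {X Y G : Set (Set ι)} (D : Set (Set ι)) (hX : IsUpperSet X) (hY : IsUpperSet Y)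
    (hG : IsUpperSet G) (hD : IsUpperSet D) (hXne : X.Nonempty) (hYne : Y.Nonempty) (hZ : ZVia X Y G) :
    CombPos (fun _ : ι => 4) (fun p => sahiE (bernoulliWeight p) 4 ![ind G, ind D, ind X, ind Y]) := by
  set K : Set (Set ι) := {ω : Set ι | ω ∪ ↑(esupp X ∪ esupp Y) ∈ G} with hK
  have hKu : IsUpperSet K := isUpperSet_forcedHull hG _
  have hGK : G ⊆ K := subset_forcedHull hG _
  -- the five comb-positive pieces
  have c1 : CombPos (fun _ : ι => 2) (covFun X (K ∩ D ∩ Y)) := combPos_covFun _ _ hX ((hKu.inter hD).inter hY)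
  have c2 : CombPos (fun _ : ι => 2) (covFun Y (K ∩ D ∩ X)) := combPos_covFun _ _ hY ((hKu.inter hD).inter hX)
  have c3 : CombPos (fun _ : ι => 2) (covFun K (D ∩ X ∩ Y)) := combPos_covFun _ _ hKu ((hD.inter hX).inter hY)
  have c4 : CombPos (fun _ : ι => 2) (covFun (D ∩ X) Y) := combPos_covFun _ _ (hD.inter hX) hY
  have c5 : CombPos (fun _ : ι => 2) (covFun X (D ∩ Y)) := combPos_covFun _ _ hX (hD.inter hY)
  have d1 : CombPos (fun _ : ι => 1) (fun p => (prodBernoulli p).real K - (prodBernoulli p).real G) :=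
    combPos_real_sub_real_of_subset hGK
  have h24 : (fun _ : ι => (2 : ℕ)) ≤ (fun _ : ι => 4) := fun _ => by norm_num
  have h12 : (fun _ : ι => (1 : ℕ)) + (fun _ : ι => 2) ≤ (fun _ : ι => 4) := fun _ => by norm_num
  have hA : CombPos (fun _ : ι => 4)
      (fun p => 2 * (covFun X (K ∩ D ∩ Y) p + covFun Y (K ∩ D ∩ X) p + covFun K (D ∩ X ∩ Y) p)) :=
    (((c1.add c2).add c3).mono h24).smul (by norm_num : (0 : ℝ) ≤ 2)
  have hB : CombPos (fun _ : ι => 4)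
      (fun p => ((prodBernoulli p).real K - (prodBernoulli p).real G) * (covFun (D ∩ X) Y p + covFun X (D ∩ Y) p)) :=
    d1.mul_of_le (c4.add c5) h12
  refine (hA.add hB).congr fun p => ?_
  have e1 : X ∩ (K ∩ D ∩ Y) = K ∩ D ∩ X ∩ Y := by ext ω; simp only [Set.mem_inter_iff]; tauto
  have e2 : Y ∩ (K ∩ D ∩ X) = K ∩ D ∩ X ∩ Y := by ext ω; simp only [Set.mem_inter_iff]; tauto
  have e3 : K ∩ (D ∩ X ∩ Y) = K ∩ D ∩ X ∩ Y := by ext ω; simp only [Set.mem_inter_iff]; tauto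
  have e5 : X ∩ (D ∩ Y) = D ∩ X ∩ Y := by ext ω; simp only [Set.mem_inter_iff]; tauto
  rw [sahiE_four_eq_of_zVia p D hX hY hG hXne hYne hZ K hK]
  simp only [covFun_eq_real, e1, e2, e3, e5]

/-- **(M⁺-4) UNCONDITIONALLY on quadruples with a `Z_3` sub-triple.**  For every finite cube and every quadruple of increasing events
`U` such that the three events other than `U_m` form a zero flag of order `3` (`SuppZeroFlag 3`), `p ↦ E_4(μ_p; 1_{U_0},…,1_{U_3})`
is a nonnegative combination of the degree-4 tensor-Bernstein basis.  (Comb lift of `sahiE_four_ind_nonneg_of_zeroFlagTriple`;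
no input of order three.) [this work] -/
theorem combPos_sahiE_four_ind_of_zeroFlagTriple (U : Fin 4 → Set (Set ι)) (hU : ∀ j, IsUpperSet (U j)) (m : Fin 4)
    (hZ : SuppZeroFlag 3 (fun j => U (m.succAbove j))) :
    CombPos (fun _ : ι => 4) (fun p => sahiE (bernoulliWeight p) 4 (fun j => ind (U j))) := by
  obtain ⟨i, h1, h2, h3⟩ := (suppZeroFlag_three_iff_exists _).1 hZ
  rcases Set.eq_empty_or_nonempty (U (m.succAbove (i.succAbove 0))) with hX0 | hXne
  · exact (CombPos.zero _).congr fun p =>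
      sahiE_ind_eq_zero_of_suppZeroFlag p (suppZeroFlag_four_of_empty U m hZ _ hX0)
  rcases Set.eq_empty_or_nonempty (U (m.succAbove (i.succAbove 1))) with hY0 | hYne
  · exact (CombPos.zero _).congr fun p =>
      sahiE_ind_eq_zero_of_suppZeroFlag p (suppZeroFlag_four_of_empty U m hZ _ hY0)
  refine (combPos_sahiE_four_of_zVia (U m) (hU _) (hU _) (hU _) (hU _) hXne hYne ⟨h1, h2, h3⟩).congr fun p => ?_
  rw [sahiE_four_reindex _ _ m i]

/-- **Density-free zeros on the `Z_3`-sub-triple class**: if `E_4(μ_q; 1_U) = 0` at ONE point `q` of the open cube then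
`E_4(μ_p; 1_U) = 0` for every `p ∈ [0,1]^ι` (so, by `sahiE_four_ind_eq_zero_iff_of_zeroFlagTriple`, `U ∈ Z_4`). [this work] -/
theorem sahiE_four_ind_eq_zero_of_interior_zero_of_zeroFlagTriple (U : Fin 4 → Set (Set ι)) (hU : ∀ j, IsUpperSet (U j))
    (m : Fin 4) (hZ : SuppZeroFlag 3 (fun j => U (m.succAbove j))) {q : ι → unitInterval}
    (hq : ∀ e, (q e : ℝ) ∈ Set.Ioo (0 : ℝ) 1) (h0 : sahiE (bernoulliWeight q) 4 (fun j => ind (U j)) = 0)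
    (p : ι → unitInterval) : sahiE (bernoulliWeight p) 4 (fun j => ind (U j)) = 0 :=
  (combPos_sahiE_four_ind_of_zeroFlagTriple U hU m hZ).eq_zero_of_interior hq h0 p

end SahiCombFourStep

end Summit.CriticalPhenomena.PercolationContinuityZ3.Theorems

end
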